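import Summits.Ventures.PercRepro.C026ForestMinor
import Summits.Ventures.PercRepro.C026DCSub

/-!
# The class lemma `(CF)` is the nonnegativity of the class slack `Δ_CF` (p6, gen 17)

(All statements are taken with the classical decidable-equality on `E`, as `slackCF` is.)

The tree carries the cell's row C-026 at the class level in two spellings: p5's predicate
`CF a b c` (`#{a ~ b ∧ c isolated from a, b in the complement} ≤ #OnePair`, `C026ForestA`) and
the integer slack `slackCF a b c = #ab|c + #ac|b + #bc|a − #N_AB` (`C026DCSub`).  They are the
same statement: `cf_iff_slackCF_nonneg`.  Hence every `(CF)`-class theorem gives `0 ≤ slackCF`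
— in particular on every forest (`slackCF_nonneg_of_forest`, from p5's `cf_any`) — which is the
hypothesis of the `(P)`-lane's k = 2 corner bridge (`C026PFunCorner`) and of THEOREM L2
(`C026PFunTwoLiveL2`).
-/

namespace PercRepro

namespace MultiGraph

open Finset

variable {V E : Type*} {G : MultiGraph V E} [Fintype E]

open Classical in
/-- `#OnePair = #ab|c + #ac|b + #bc|a` (the three cells of `slackCF`). -/
theorem card_onePair_eq (a b c : V) :
    (univ.filter fun ω : Config E => G.OnePair ω a b c).card =
      (univ.filter fun ω : Config E => G.Conn ω a b ∧ ¬ G.Conn ω a c).card +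
        (univ.filter fun ω : Config E => G.Conn ω c a ∧ ¬ G.Conn ω c b).card +
        (univ.filter fun ω : Config E => G.Conn ω c b ∧ ¬ G.Conn ω c a).card := by
  have hsplit : (univ.filter fun ω : Config E => G.OnePair ω a b c) =
      ((univ.filter fun ω : Config E => G.Conn ω a b ∧ ¬ G.Conn ω a c) ∪
        (univ.filter fun ω : Config E => G.Conn ω c a ∧ ¬ G.Conn ω c b)) ∪
        (univ.filter fun ω : Config E => G.Conn ω c b ∧ ¬ G.Conn ω c a) := by
    ext ω
    simp only [Finset.mem_union, Finset.mem_filter, Finset.mem_univ, true_and, OnePair]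
    constructor
    · rintro (h | ⟨h1, h2⟩ | ⟨h1, h2⟩)
      · exact Or.inl (Or.inl h)
      · exact Or.inl (Or.inr ⟨h1.symm, fun h => h2 (h1.trans h)⟩)
      · exact Or.inr ⟨h1.symm, fun h => h2 (h.symm.trans h1.symm)⟩
    · rintro ((h | ⟨h1, h2⟩) | ⟨h1, h2⟩)
      · exact Or.inl h
      · exact Or.inr (Or.inl ⟨h1.symm, fun h => h2 (h1.trans h)⟩)
      · exact Or.inr (Or.inr ⟨h1.symm, fun h => h2 (h1.trans h.symm)⟩)
  rw [hsplit, Finset.card_union_of_disjoint, Finset.card_union_of_disjoint]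
  · rw [Finset.disjoint_filter]
    rintro ω _ ⟨_, h2⟩ ⟨h3, _⟩
    exact h2 h3.symm
  · rw [Finset.disjoint_union_left]
    constructor
    · rw [Finset.disjoint_filter]
      rintro ω _ ⟨h1, h2⟩ ⟨h3, _⟩
      exact h2 (h3.trans h1.symm).symm
    · rw [Finset.disjoint_filter]
      rintro ω _ ⟨h1, h2⟩ ⟨h3, _⟩
      exact h2 h3

open Classical in
/-- The `N_AB` cell of `slackCF` is the left-hand cell of `CF`. -/
theorem card_nab_eq (a b c : V) :
    (univ.filter fun S : Config E => G.Conn S a b ∧ G.IsCIso Sᶜ a b c).card =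
      (univ.filter fun ω : Config E =>
        G.Conn ω a b ∧ ¬ G.Conn ωᶜ c a ∧ ¬ G.Conn ωᶜ c b).card := by
  congr 1
  ext ω
  simp only [Finset.mem_filter, Finset.mem_univ, true_and, IsCIso, conn_comm]

open Classical in
/-- **`(CF)` is `0 ≤ Δ_CF`**: p5's class lemma `CF a b c` and the nonnegativity of the class slack
`slackCF a b c` are the same statement. -/
theorem cf_iff_slackCF_nonneg (a b c : V) : G.CF a b c ↔ 0 ≤ G.slackCF a b c := by
  unfold CF slackCF
  rw [card_onePair_eq, card_nab_eq, sub_nonneg]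
  constructor <;> intro h <;> exact_mod_cast h

open Classical in
/-- `0 ≤ Δ_CF` on every forest, for every marks (p5's `cf_any`). -/
theorem slackCF_nonneg_of_forest (hF : G.IsForest) (a b c : V) : 0 ≤ G.slackCF a b c :=
  (cf_iff_slackCF_nonneg a b c).1 (G.cf_any hF a b c)

end MultiGraph

end PercRepro
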